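import Summits.AtomisticToContinuum.HydrodynamicLimit.Theorems.LambertianContactSwapContactAngleEquidistributionEqCentring
import Summits.AtomisticToContinuum.HydrodynamicLimit.Theorems.LambertianContactSwapContactAngleEquidistributionNearFieldCosineEq
import Literature.MathematicalPhysics.KineticTheory.HardSphereCampbellFormulaHolds
import HarnessLib

/-!
# The equilibrium layer of line `Sketch`, UNCONDITIONAL (crux `LambertianContactSwap.ContactAngleEquidistribution`,
# stmt-AtomisticToContinuum-12097; lead c4)

Helper file (`--supports stmt-AtomisticToContinuum-12097`). Two registered sub-goals of the line's equilibrium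
layer were landed CONDITIONAL on the named fact `HardSphereCampbellFormula` (Cercignani–Illner–Pulvirenti 1994,
App. 4.A, special-flow / Campbell identity): `stub_costEqCentring` (lead c1, p119578: under the homogeneous Gibbs
law the mean of the ISOLATED speed-capped `κ_g`-centred contact-angle functional `A^V_N` is EXACTLY `0` for every
`N` — the mean part of the open stub `stub_cost`) and `stub_nearFieldCosineEq` (lead c1, p121638: T1'
`NearFieldAdmissibleCosineLawBall` holds EXACTLY at equilibrium for every `N`). Lead c3 discharged the fact
(`hardSphereCampbellFormula_holds`, p130405). This file records the two unconditional consequences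
(`costEqCentring_unconditional`, `nearFieldCosineEq_unconditional`), completing the statement that the
EQUILIBRIUM CONTENT of each open stub of the transfer kernel is a theorem; what remains open is out of equilibrium
(`Cruxes/ContactAngleEquidistribution/NOTES.md` §B).

References: C. Cercignani, R. Illner, M. Pulvirenti, *The Mathematical Theory of Dilute Gases* (1994), App. 4.A
pp. 107–111.
-/

noncomputable section

open MeasureTheory Filter Set Topology ProbabilityTheory
open scoped ENNReal BigOperators Classical RealInnerProductSpace

namespace Summit.AtomisticToContinuum.HydrodynamicLimit.Theorems.ContactAngleEquidistributionSketch

open Literature.Analysis.FluidPDE Literature.MathematicalPhysics.KineticTheory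

/-- **Exact equilibrium centring of the isolated stratum, UNCONDITIONAL**: under the homogeneous Gibbs law
`Q_N = localGibbsLaw σ 1 0 θe` the mean of the isolated (midpoint-ball), speed-capped, `κ_g`-centred contact-angle
hit-sum is `0` for EVERY `N`, every `t ≥ 0`, every cap `V > 0` and every admissible `ψ_N` — `stub_costEqCentring`
with `HardSphereCampbellFormula` discharged by `hardSphereCampbellFormula_holds`. [cite: CIP1994, App. 4.A pp. 107–111] -/
theorem costEqCentring_unconditional :
    let Cfg : ℕ → Type := fun N => Config (N + 1) (Fin 3) T3
    let G := Torus.geometry (Fin 3)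
    let ε : ℝ → ℕ → ℝ := hsDiameter
    let τ : ℝ → (N : ℕ) → Cfg N → ℝ≥0∞ := fun σ N z => Alexander.freeExitTime G (ε σ N) z
    let S : ℝ → (N : ℕ) → Cfg N → Cfg N := fun t _ z => freeFlight G t z
    let ldir : V3 → V3 → V3 := fun ω ξ => ‖‖ω‖⁻¹ • ω + ‖ξ‖⁻¹ • ξ‖⁻¹ • (‖ω‖⁻¹ • ω + ‖ξ‖⁻¹ • ξ)
    let zpre : ℝ → (N : ℕ) → Cfg N → ℕ → Cfg N := fun σ N z m =>
      let y := Alexander.stateAfter G (ε σ N) z m; S (τ σ N y).toReal N y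
    let Kt : ℝ → (N : ℕ) → Cfg N → ℝ → ℕ := fun σ N z t => Alexander.collisionCount G (ε σ N) z t
    let hit : ℝ → (N : ℕ) → Cfg N → Fin (N + 1) → Fin (N + 1) → Prop := fun σ N y i j =>
      i < j ∧ y ∈ contactSet G (N + 1) (ε σ N) i j ∧ IsIncoming G y i j
    let tcol : ℝ → (N : ℕ) → Cfg N → ℕ → ℝ := fun σ N z m =>
      (Alexander.collisionInstant G (ε σ N) z (m + 1)).toReal
    let xmid : (N : ℕ) → Cfg N → Fin (N + 1) → Fin (N + 1) → T3 := fun _ y i j =>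
      G.translate (y j).1 ((2 : ℝ)⁻¹ • G.sepVec (y i).1 (y j).1)
    let near : ℝ → (N : ℕ) → Cfg N → Fin (N + 1) → Fin (N + 1) → Prop := fun σ N y i j =>
      ∃ k : Fin (N + 1), k ≠ i ∧ k ≠ j ∧ ‖G.sepVec (y k).1 (xmid N y i j)‖ ≤ 3 * ε σ N
    ∀ θe : ℝ, 0 < θe → ∃ σ₀ : ℝ, 0 < σ₀ ∧ ∀ σ : ℝ, 0 < σ → σ < σ₀ →
      ∀ Φ : (N : ℕ) → HardSphereFlow G (ε σ N) (N + 1),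
      let Q := fun N => localGibbsLaw σ (fun _ => 1) (fun _ => 0) (fun _ => θe) N (Φ N)
      ∀ t : ℝ, 0 ≤ t → ∀ V : ℝ, 0 < V →
      ∀ ψ : ℕ → ℝ → T3 → V3 → V3 → V3 → ℝ,
        (∀ N, Measurable (fun p : ℝ × T3 × V3 × V3 × V3 =>
          ψ N p.1 p.2.1 p.2.2.1 p.2.2.2.1 p.2.2.2.2)) →
        (∀ N s x v w n, |ψ N s x v w n| ≤ 1) →
        ∀ N : ℕ, ∫ z, ((N : ℝ) + 1) ^ (-(4 / 3 : ℝ)) *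
          ∑ m ∈ Finset.range (Kt σ N z t), ∑ i : Fin (N + 1), ∑ j : Fin (N + 1),
            (let y := zpre σ N z m
             if hit σ N y i j then
               (if near σ N y i j then 0 else if V < ‖(y i).2 - (y j).2‖ then 0 else
                 ‖(y i).2 - (y j).2‖ ^ 2 *
                   (ψ N (tcol σ N z m) (xmid N y i j) (y i).2 (y j).2
                       ((ε σ N)⁻¹ • G.sepVec (y i).1 (y j).1) -
                     ∫ ξ, ψ N (tcol σ N z m) (xmid N y i j) (y i).2 (y j).2
                       (ldir (-((y i).2 - (y j).2)) ξ) ∂(stdGaussian V3)))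
             else 0) ∂(Q N) = 0 :=
  stub_costEqCentring hardSphereCampbellFormula_holds

/-- **T1' holds exactly at equilibrium, UNCONDITIONAL**: the near-field admissible-conditioned cosine law
(`NearFieldAdmissibleCosineLawBall` restricted to the homogeneous Gibbs law) has mean `0` for every `N` —
`stub_nearFieldCosineEq` with `HardSphereCampbellFormula` discharged by `hardSphereCampbellFormula_holds`.
[cite: CIP1994, App. 4.A pp. 107–111] -/
theorem nearFieldCosineEq_unconditional :
    let Cfg : ℕ → Type := fun N => Config (N + 1) (Fin 3) T3
    let G := Torus.geometry (Fin 3)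
    let ε : ℝ → ℕ → ℝ := hsDiameter
    let τ : ℝ → (N : ℕ) → Cfg N → ℝ≥0∞ := fun σ N z => Alexander.freeExitTime G (ε σ N) z
    let S : ℝ → (N : ℕ) → Cfg N → Cfg N := fun t _ z => freeFlight G t z
    let zpre : ℝ → (N : ℕ) → Cfg N → ℕ → Cfg N := fun σ N z m =>
      let y := Alexander.stateAfter G (ε σ N) z m; S (τ σ N y).toReal N y
    let Kt : ℝ → (N : ℕ) → Cfg N → ℝ → ℕ := fun σ N z t => Alexander.collisionCount G (ε σ N) z t
    let hit : ℝ → (N : ℕ) → Cfg N → Fin (N + 1) → Fin (N + 1) → Prop := fun σ N y i j =>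
      i < j ∧ y ∈ contactSet G (N + 1) (ε σ N) i j ∧ IsIncoming G y i j
    let tcol : ℝ → (N : ℕ) → Cfg N → ℕ → ℝ := fun σ N z m =>
      (Alexander.collisionInstant G (ε σ N) z (m + 1)).toReal
    let xmid : (N : ℕ) → Cfg N → Fin (N + 1) → Fin (N + 1) → T3 := fun _ y i j =>
      G.translate (y j).1 ((2 : ℝ)⁻¹ • G.sepVec (y i).1 (y j).1)
    let near : ℝ → (N : ℕ) → Cfg N → Fin (N + 1) → Fin (N + 1) → Prop := fun σ N y i j =>
      ∃ k : Fin (N + 1), k ≠ i ∧ k ≠ j ∧ ‖G.sepVec (y k).1 (xmid N y i j)‖ ≤ 3 * ε σ N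
    let adm : ℝ → (N : ℕ) → Cfg N → Fin (N + 1) → Fin (N + 1) → Set V3 := fun σ N y i j =>
      admissibleNormalsBall (ε σ N) y i j (xmid N y i j)
    ∀ θe : ℝ, 0 < θe → ∃ σ₀ : ℝ, 0 < σ₀ ∧ ∀ σ : ℝ, 0 < σ → σ < σ₀ →
      ∀ Φ : (N : ℕ) → HardSphereFlow G (ε σ N) (N + 1),
      let Q := fun N => localGibbsLaw σ (fun _ => 1) (fun _ => 0) (fun _ => θe) N (Φ N)
      ∀ t : ℝ, 0 ≤ t → ∀ V : ℝ, 0 < V →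
      ∀ ψ : ℕ → ℝ → T3 → V3 → V3 → V3 → ℝ,
        (∀ N, Measurable (fun p : ℝ × T3 × V3 × V3 × V3 =>
          ψ N p.1 p.2.1 p.2.2.1 p.2.2.2.1 p.2.2.2.2)) →
        (∀ N s x v w n, |ψ N s x v w n| ≤ 1) →
        ∀ N : ℕ, ∫ z, ((N : ℝ) + 1) ^ (-(4 / 3 : ℝ)) *
          ∑ m ∈ Finset.range (Kt σ N z t), ∑ i : Fin (N + 1), ∑ j : Fin (N + 1),
            (let y := zpre σ N z m
             if hit σ N y i j then
               (if near σ N y i j then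
                 (if V < ‖(y i).2 - (y j).2‖ then 0 else
                   ‖(y i).2 - (y j).2‖ ^ 2 *
                     (ψ N (tcol σ N z m) (xmid N y i j) (y i).2 (y j).2
                         ((ε σ N)⁻¹ • G.sepVec (y i).1 (y j).1) -
                       admissibleCosineMean (adm σ N y i j) ((y i).2 - (y j).2)
                         (ψ N (tcol σ N z m) (xmid N y i j) (y i).2 (y j).2)))
                else 0)
             else 0) ∂(Q N) = 0 :=
  stub_nearFieldCosineEq hardSphereCampbellFormula_holds

end Summit.AtomisticToContinuum.HydrodynamicLimit.Theorems.ContactAngleEquidistributionSketch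

end
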